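/-
Copyright (c) 2026 the pub-hodgecm-mathlib formalisation cell (harness21).  Prover seat hodgecm-mathlib-K2E5-p16 (g3) (cross-unit hand on E3's BONUS road (d-w) of ‹J3› v2,
road owner K2E3-p03 (g3); deal (D48) «(C-ratio) COUNT», brick (C2a) «torus» of the road owner's split 2026-09-04T03:23:05Z): the norm-one torus factor of `N_an` at level `2ϖ_v`.
-/
import Literature.NumberTheory.Automorphic.RamifiedPlaceNormOneTorusIndex   -- ★ LH4-p02: `relIndex_normOne_top_eq_two_mul_pow` (Flicker Prop. 7(b), any residue char.), + ★ `RamifiedPlaceNormOneTorus` (`valued_sub_one_le_of_le_odd_of_norm_one` «no odd steps»)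
import Literature.NumberTheory.Automorphic.RamifiedPlaceEisensteinBasis     -- ★ `valued_toPlace_eq_sq_of_ramified` (`|ι_w y|_w = |y|_v²`)
import HarnessLib

/-!
# K2 ∕ E3, road (d-w) of ‹J3› v2 — (C2a) `K2E3WildPlaneTorusCount`: THE NORM-ONE TORUS COUNT AT LEVEL `2ϖ_v`, BOTH WILD TYPES: `[E¹ : E¹(2ϖ_v)] = 2·q_v^{m+1−k}` (√u, `d = 2k`)
# and `= 2·q_v` (√π, `d = 2m+1`) — thin corollaries of ★ Flicker's index `[T : T⁽ᵈ⁺²ʲ⁾] = 2·q_v^j` and ★ «no odd steps»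

Cell `hodgecm-mathlib` (Track B «K2-LIT»), item h413 = `stmt-HodgeConjecture-24833`, route of record `route-HodgeConjecture-HCCMUnconditional`; PROOF lane (theorems only:
no `def`, no `instance`, no `notation`, no named fact, no `sorry`), `--supports stmt-HodgeConjecture-24833 --as helper`; count-neutral.  ROAD (d-w): the residual letter (W3)
⟸ (L-eq) ★ p857013 + (C-ratio) (cand `sig_K2E3WildPlaneCountRatio`, K2E3-p03 (g3)); (C-ratio) = (C1) `N_iso` + (C2a) torus + (C2b) quaternion + (C3) arithmetic (road owner's
split).  By the dictionary `U_an = U(⟨1,−ξ⟩)(L⁺_v) ≅ SU_an ⋊ {diag(1,ε) : ε ∈ E¹}` (E¹ = the norm-one torus of `L_w ∕ L⁺_v`), the congruence subgroup `K_an(2ϖ_v)` meets the torus in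
`E¹(2ϖ_v) := {ε : |ε − 1|_w ≤ |2ϖ_v|_w}`, and `|2ϖ_v|_w = exp(−(2m+2))` (`m = ord_v 2`, `e(w|v) = 2`).  THIS FILE: `[E¹ : E¹(2ϖ_v)]` in the hypothesis-characterised subgroup
currency of ★ `RamifiedPlaceNormOneTorusIndex` (subgroups of `L_wˣ`, `σ_w = galAdicCompletionMap c hw`, `d` = the different exponent `|σ_wτ − τ| = exp(−d)`):
* §1 `valued_toPlace_two_mul_eq` — `|ι_w(2ϖ_v)|_w = exp(−(2m+2))` (★ `valued_toPlace_eq_sq_of_ramified`).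
* §2 √u (EVEN `d = 2k`, `k ≤ m + 1`): **`relIndex_normOne_level_eq_of_even`** — `[T : T(exp(−(2m+2)))] = 2·q_v^{m+1−k}` (★ Flicker index at `j = m + 1 − k`: `exp(−2j)·exp(−d) = exp(−(2m+2))`).
* §3 ODD `d = 2k + 1` (the √π places have `d = 2m+1`): **`relIndex_normOne_level_succ_eq_of_odd`** — `[T : T(exp(−(d+1)))] = 2·q_v` (★ «no odd steps» `T⁽ᵈ⁺¹⁾ = T⁽ᵈ⁺²⁾` + ★ index at
  `j = 1`); for `d = 2m + 1` this is the level `2m + 2 = v_w(2ϖ_v)`.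
* §4–§5 (ED. 2, after the road owner's LEVEL CLARIFICATION 03:29:34Z: the (C-ratio) cand sits at radius `a = resChar = 2`, i.e. group level `K(4)`, w-depth `4m`):
  `relIndex_normOne_level_odd_step_eq` (`[T : T(exp(−(d+2j+1)))] = 2·q_v^{j+1}`), `valued_four_eq` (`|4|_w = exp(−4m)`), and AT DEPTH `4m`:
  **`relIndex_normOne_depth_four_mul_eq_of_even`** (√u, `d = 2k`: `2·q_v^{2m−k}`) and **`relIndex_normOne_depth_four_mul_eq_of_odd`** (√π, `d = 2m+1`: `2·q_v^m`) = the TARGETS table's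
  (C2a) values on the nose.
Numerics (K2E5-p16 (g3) note `WILD-PLANE-COUNT-CHECK`, m = 1, q = 2): `[E¹ : E¹(4)] = 4` at `ℚ₂(i), ℚ₂(√3)` (k = 1: `2·2¹`) and at `ℚ₂(√2), ℚ₂(√−2)` (`2·2`) ✓.
LEVELS: §2∕§3 are written at depth `2m + 2 = v_w(2ϖ_v)`; the road owner's TARGETS table (1e1bb947) and the (C-ratio) cand are at depth `4m = v_w(4)` — §5 (ED. 2) gives exactly
the table's `2q^{2m−k}` ∕ `2q^m` there (the two depths agree at m = 1).

HONEST LABEL: HC_CM is proved only modulo the 7 printed citations (2 remaining named inputs: hLiu418 = stmt-HodgeConjecture-24832, h413 = stmt-HodgeConjecture-24833) until rung 0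
closes; (W3)∕(C-ratio) are NOT proved here; count-neutral input (C2a) for the (C3) assembler.

## References
* [Flicker1998UnitaryFL] Y. Z. Flicker, *Elementary proof of the fundamental lemma for a unitary group*, Canad. J. Math. 50 (1998) — Prop. 7 (b) p. 84 (`[R_E¹ : R_E(j)¹] = q^j`).
* [Serre1979] J.-P. Serre, *Local Fields*, GTM 67 (1979) — Ch. V §3 (filtration of the norm-one torus of a totally ramified quadratic extension), Ch. X §1 (Hilbert 90).
* [Kottwitz1988] R. Kottwitz, *Tamagawa numbers*, Ann. of Math. 127 (1988) — §1 Thm. 1 (the place-freeness the (C-ratio) letter expresses).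
-/

set_option autoImplicit false
set_option linter.dupNamespace false

noncomputable section

namespace Summit.HodgeConjecture.HodgeConjecture.Cruxes.H413.K2E3WildPlaneTorusCount

open WithZero NumberField IsDedekindDomain ValuativeRel
open scoped ValuativeRel
open Literature.NumberTheory.Automorphic Literature.NumberTheory.Automorphic.UnitaryGroup

variable (L : Type) [Field L] [NumberField L] [IsCMField L] (v : HeightOneSpectrum (𝓞 ↥(maximalRealSubfield L)))
  (w : PlacesOver L v) (hw : IsCMField.complexConj L • w.1 = w.1) (he : v.asIdeal.ramificationIdx' w.1.asIdeal ≠ 1)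

/-! ## §1 The level `2ϖ_v` read at `w` -/

include hw he in
/-- **`|ι_w(2ϖ_v)|_w = exp(−(2m+2))`** at a ramified place (`e(w|v) = 2`): `|2|_v = exp(−m)`, `|ϖ_v|_v = exp(−1)`, `|ι_w y|_w = |y|_v²` (★ `valued_toPlace_eq_sq_of_ramified`).
[cite: Serre1979, Ch. IV §1] -/
theorem valued_toPlace_two_mul_eq {m : ℕ} (hm : Valued.v (2 : v.adicCompletion ↥(maximalRealSubfield L)) = exp (-(m : ℤ)))
    {ϖ : v.adicCompletion ↥(maximalRealSubfield L)} (hϖ : Valued.v ϖ = exp (-1 : ℤ)) :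
    Valued.v (toPlace v w (2 * ϖ)) = exp (-(2 * (m : ℤ) + 2)) := by
  rw [valued_toPlace_eq_sq_of_ramified L v w hw he, map_mul, hm, hϖ, ← exp_add, ← exp_nsmul]
  congr 1
  rw [nsmul_eq_mul]
  push_cast
  ring

/-! ## §2 Even different exponent (√u): `[T : T(exp(−(2m+2)))] = 2·q_v^{m+1−k}` -/

include he in
/-- **(C2a), √u.**  At a ramified CM place with EVEN different exponent `d = 2k` (`|σ_wτ − τ| = exp(−d)` for a uniformiser `τ` of `L_w`) and `k ≤ m + 1`: for the norm-one torus
`T = {t : σ_w t · t = 1}` and its level `T_n = {t ∈ T : |t − 1| ≤ exp(−(2m+2))}` (= `E¹(2ϖ_v)` when `m = ord_v 2`, §1), `[T : T_n] = 2 · q_v^{m+1−k}` — ★ Flicker's index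
`[T : T⁽ᵈ⁺²ʲ⁾] = 2·q_v^j` at `j = m + 1 − k`. [cite: Flicker1998UnitaryFL, Prop. 7 p. 84] [cite: Serre1979, Ch. V §3, Ch. X §1] -/
theorem relIndex_normOne_level_eq_of_even {τ : w.1.adicCompletion L} (hτ : Valued.v τ = exp (-1 : ℤ)) {d k m : ℕ}
    (hd : Valued.v (galAdicCompletionMap (L := L) (IsCMField.complexConj L) hw τ - τ) = exp (-(d : ℤ))) (hk : d = 2 * k) (hkm : k ≤ m + 1)
    (T Tn : Subgroup (w.1.adicCompletion L)ˣ)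
    (hT : ∀ t : (w.1.adicCompletion L)ˣ, t ∈ T ↔ galAdicCompletionMap (L := L) (IsCMField.complexConj L) hw (t : w.1.adicCompletion L) * t = 1)
    (hTn : ∀ t : (w.1.adicCompletion L)ˣ, t ∈ Tn ↔ galAdicCompletionMap (L := L) (IsCMField.complexConj L) hw (t : w.1.adicCompletion L) * t = 1 ∧
      Valued.v ((t : w.1.adicCompletion L) - 1) ≤ exp (-(2 * (m : ℤ) + 2))) :
    Tn.relIndex T = 2 * Nat.card 𝓀[v.adicCompletion ↥(maximalRealSubfield L)] ^ (m + 1 - k) := by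
  have hlev : exp (-(2 * ((m + 1 - k : ℕ) : ℤ))) * Valued.v (galAdicCompletionMap (L := L) (IsCMField.complexConj L) hw τ - τ) = exp (-(2 * (m : ℤ) + 2)) := by
    rw [hd, ← exp_add]
    congr 1
    push_cast [Nat.cast_sub hkm, hk]
    ring
  refine relIndex_normOne_top_eq_two_mul_pow L v w hw he hτ (m + 1 - k) T Tn hT fun t => ?_
  rw [hTn, hlev]

/-! ## §3 Odd different exponent (√π): `[T : T(exp(−(d+1)))] = 2·q_v` -/

include he in
/-- **(C2a), √π.**  At a ramified CM place with ODD different exponent `d = 2k + 1` (for the √π places of a dyadic `v`, `d = 2m + 1` and `d + 1 = 2m + 2 = v_w(2ϖ_v)`): for the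
norm-one torus `T` and `T' = {t ∈ T : |t − 1| ≤ exp(−(d+1))}`, `[T : T'] = 2 · q_v` — ★ «no odd steps» (`T⁽ᵈ⁺¹⁾ = T⁽ᵈ⁺²⁾`, `valued_sub_one_le_of_le_odd_of_norm_one`) and ★ Flicker's
index at `j = 1`. [cite: Flicker1998UnitaryFL, Prop. 7 p. 84] [cite: Serre1979, Ch. V §3, Ch. X §1] -/
theorem relIndex_normOne_level_succ_eq_of_odd {τ : w.1.adicCompletion L} (hτ : Valued.v τ = exp (-1 : ℤ)) {d : ℕ}
    (hd : Valued.v (galAdicCompletionMap (L := L) (IsCMField.complexConj L) hw τ - τ) = exp (-(d : ℤ)))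
    (T T' : Subgroup (w.1.adicCompletion L)ˣ)
    (hT : ∀ t : (w.1.adicCompletion L)ˣ, t ∈ T ↔ galAdicCompletionMap (L := L) (IsCMField.complexConj L) hw (t : w.1.adicCompletion L) * t = 1)
    (hT' : ∀ t : (w.1.adicCompletion L)ˣ, t ∈ T' ↔ galAdicCompletionMap (L := L) (IsCMField.complexConj L) hw (t : w.1.adicCompletion L) * t = 1 ∧
      Valued.v ((t : w.1.adicCompletion L) - 1) ≤ exp (-((d : ℤ) + 1))) :
    T'.relIndex T = 2 * Nat.card 𝓀[v.adicCompletion ↥(maximalRealSubfield L)] := by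
  have key := relIndex_normOne_top_eq_two_mul_pow L v w hw he hτ 1 T T' hT fun t => ?_
  · rw [pow_one] at key; exact key
  rw [hT']
  constructor
  · rintro ⟨ht, hle⟩
    refine ⟨ht, ?_⟩
    have hle' : Valued.v ((t : w.1.adicCompletion L) - 1) ≤
        exp (-(2 * (0 : ℕ) + 1 : ℤ)) * Valued.v (galAdicCompletionMap (L := L) (IsCMField.complexConj L) hw τ - τ) := by
      refine le_of_le_of_eq hle ?_
      rw [hd, ← exp_add]; congr 1; push_cast; ring
    have h := valued_sub_one_le_of_le_odd_of_norm_one L v w hw he hτ ht 0 hle'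
    refine h.trans (le_of_eq ?_)
    norm_num
  · rintro ⟨ht, hle⟩
    refine ⟨ht, hle.trans ?_⟩
    rw [hd, ← exp_add, exp_le_exp]; push_cast; omega

/-! ## §4 (ED. 2) General odd step: `[T : T(exp(−(d+2j+1)))] = 2·q_v^{j+1}` -/

include he in
/-- **ODD STEPS COST NOTHING**: for every `j`, `T⁽ᵈ⁺²ʲ⁺¹⁾ = T⁽ᵈ⁺²ʲ⁺²⁾` (★ `valued_sub_one_le_of_le_odd_of_norm_one`), hence `[T : T(exp(−(d+2j+1)))] = 2·q_v^{j+1}` (★ Flicker at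
`j + 1`). [cite: Flicker1998UnitaryFL, Prop. 7 p. 84] [cite: Serre1979, Ch. V §3, Ch. X §1] -/
theorem relIndex_normOne_level_odd_step_eq {τ : w.1.adicCompletion L} (hτ : Valued.v τ = exp (-1 : ℤ)) {d : ℕ}
    (hd : Valued.v (galAdicCompletionMap (L := L) (IsCMField.complexConj L) hw τ - τ) = exp (-(d : ℤ))) (j : ℕ)
    (T T' : Subgroup (w.1.adicCompletion L)ˣ)
    (hT : ∀ t : (w.1.adicCompletion L)ˣ, t ∈ T ↔ galAdicCompletionMap (L := L) (IsCMField.complexConj L) hw (t : w.1.adicCompletion L) * t = 1)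
    (hT' : ∀ t : (w.1.adicCompletion L)ˣ, t ∈ T' ↔ galAdicCompletionMap (L := L) (IsCMField.complexConj L) hw (t : w.1.adicCompletion L) * t = 1 ∧
      Valued.v ((t : w.1.adicCompletion L) - 1) ≤ exp (-((d : ℤ) + 2 * j + 1))) :
    T'.relIndex T = 2 * Nat.card 𝓀[v.adicCompletion ↥(maximalRealSubfield L)] ^ (j + 1) := by
  refine relIndex_normOne_top_eq_two_mul_pow L v w hw he hτ (j + 1) T T' hT fun t => ?_
  rw [hT']
  constructor
  · rintro ⟨ht, hle⟩
    refine ⟨ht, ?_⟩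
    have hle' : Valued.v ((t : w.1.adicCompletion L) - 1) ≤
        exp (-(2 * j + 1 : ℤ)) * Valued.v (galAdicCompletionMap (L := L) (IsCMField.complexConj L) hw τ - τ) := by
      refine le_of_le_of_eq hle ?_
      rw [hd, ← exp_add]; congr 1; ring
    exact valued_sub_one_le_of_le_odd_of_norm_one L v w hw he hτ ht j hle'
  · rintro ⟨ht, hle⟩
    refine ⟨ht, hle.trans ?_⟩
    rw [hd, ← exp_add, exp_le_exp]; push_cast; omega

/-! ## §5 (ED. 2) The depth `4m` of the (C-ratio) cand (`a = resChar = 2`, group level `K(4)`, `|4|_w = exp(−4m)`): both types -/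

include hw he in
/-- `|4|_w = exp(−4m)` at a ramified place above `v` with `|2|_v = exp(−m)` (`|ι_w 2|_w = |2|_v²`). [cite: Serre1979, Ch. IV §1] -/
theorem valued_four_eq {m : ℕ} (hm : Valued.v (2 : v.adicCompletion ↥(maximalRealSubfield L)) = exp (-(m : ℤ))) :
    Valued.v (4 : w.1.adicCompletion L) = exp (-(4 * (m : ℤ))) := by
  have h2 : Valued.v (2 : w.1.adicCompletion L) = exp (-(2 * (m : ℤ))) := by
    rw [← map_ofNat (toPlace v w) 2, valued_toPlace_eq_sq_of_ramified L v w hw he, hm, ← exp_nsmul]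
    congr 1; rw [nsmul_eq_mul]; push_cast; ring
  rw [show (4 : w.1.adicCompletion L) = 2 * 2 by norm_num, map_mul, h2, ← exp_add]
  congr 1; ring

include he in
/-- **(C2a) AT DEPTH `4m`, √u (`d = 2k`, `k ≤ 2m`, `1 ≤ m`)**: `[T : T(exp(−4m))] = 2·q_v^{2m−k}` — the torus factor `[E¹ : E¹(4)]` of `N_an` in the road owner's TARGETS table
(§2 at depth `2(2m−1)+2 = 4m`). [cite: Flicker1998UnitaryFL, Prop. 7 p. 84] [cite: Serre1979, Ch. V §3] -/
theorem relIndex_normOne_depth_four_mul_eq_of_even {τ : w.1.adicCompletion L} (hτ : Valued.v τ = exp (-1 : ℤ)) {d k m : ℕ}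
    (hd : Valued.v (galAdicCompletionMap (L := L) (IsCMField.complexConj L) hw τ - τ) = exp (-(d : ℤ))) (hk : d = 2 * k) (hkm : k ≤ 2 * m) (hm1 : 1 ≤ m)
    (T Tn : Subgroup (w.1.adicCompletion L)ˣ)
    (hT : ∀ t : (w.1.adicCompletion L)ˣ, t ∈ T ↔ galAdicCompletionMap (L := L) (IsCMField.complexConj L) hw (t : w.1.adicCompletion L) * t = 1)
    (hTn : ∀ t : (w.1.adicCompletion L)ˣ, t ∈ Tn ↔ galAdicCompletionMap (L := L) (IsCMField.complexConj L) hw (t : w.1.adicCompletion L) * t = 1 ∧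
      Valued.v ((t : w.1.adicCompletion L) - 1) ≤ exp (-(4 * (m : ℤ)))) :
    Tn.relIndex T = 2 * Nat.card 𝓀[v.adicCompletion ↥(maximalRealSubfield L)] ^ (2 * m - k) := by
  have hlev : exp (-(2 * ((2 * m - 1 : ℕ) : ℤ) + 2)) = exp (-(4 * (m : ℤ))) := by
    congr 1; push_cast [Nat.cast_sub (by omega : 1 ≤ 2 * m)]; ring
  have hexp : 2 * m - 1 + 1 - k = 2 * m - k := by omega
  rw [← hexp]
  refine relIndex_normOne_level_eq_of_even L v w hw he hτ hd hk (by omega) T Tn hT fun t => ?_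
  rw [hTn, hlev]

include he in
/-- **(C2a) AT DEPTH `4m`, √π (`d = 2m + 1`, `1 ≤ m`)**: `[T : T(exp(−4m))] = 2·q_v^m` — the torus factor of `N_an` in the road owner's TARGETS table (§4 at `j = m − 1`:
`4m = d + 2(m−1) + 1` is an odd step above `d`). [cite: Flicker1998UnitaryFL, Prop. 7 p. 84] [cite: Serre1979, Ch. V §3] -/
theorem relIndex_normOne_depth_four_mul_eq_of_odd {τ : w.1.adicCompletion L} (hτ : Valued.v τ = exp (-1 : ℤ)) {d m : ℕ}
    (hd : Valued.v (galAdicCompletionMap (L := L) (IsCMField.complexConj L) hw τ - τ) = exp (-(d : ℤ))) (hdm : d = 2 * m + 1) (hm1 : 1 ≤ m)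
    (T Tn : Subgroup (w.1.adicCompletion L)ˣ)
    (hT : ∀ t : (w.1.adicCompletion L)ˣ, t ∈ T ↔ galAdicCompletionMap (L := L) (IsCMField.complexConj L) hw (t : w.1.adicCompletion L) * t = 1)
    (hTn : ∀ t : (w.1.adicCompletion L)ˣ, t ∈ Tn ↔ galAdicCompletionMap (L := L) (IsCMField.complexConj L) hw (t : w.1.adicCompletion L) * t = 1 ∧
      Valued.v ((t : w.1.adicCompletion L) - 1) ≤ exp (-(4 * (m : ℤ)))) :
    Tn.relIndex T = 2 * Nat.card 𝓀[v.adicCompletion ↥(maximalRealSubfield L)] ^ m := by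
  have hlev : exp (-((d : ℤ) + 2 * ((m - 1 : ℕ) : ℤ) + 1)) = exp (-(4 * (m : ℤ))) := by
    congr 1; push_cast [Nat.cast_sub hm1, hdm]; ring
  have hexp : m - 1 + 1 = m := by omega
  conv_rhs => rw [← hexp]
  refine relIndex_normOne_level_odd_step_eq L v w hw he hτ hd (m - 1) T Tn hT fun t => ?_
  rw [hTn, hlev]

end Summit.HodgeConjecture.HodgeConjecture.Cruxes.H413.K2E3WildPlaneTorusCount

end
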